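import Summits.Ventures.CertifiedManyBodySolver.Theorems.M3x2EdgeSplitSymReplayGramRShardsLocal
import HarnessLib

/-!
# SymReplay gramR — generic R-shard soundness and GROUPED R-shards (module 3/3 of `GramRShardsFast`, rev 3 §(f′)+(h)+(i))
(pen hub-lb-sym-plan-1 g2, 2026-08-28, rev 3 = crux workfile `Cruxes/LowerEdge_ge_m83o100/GramRShardsFast_symplan1.lean`
13be81b55085, sha16 0bff438c521d194e; landed by the one writer hub-lb-sym-eng-3.  ADDITIVE on `…GramRShardsFast` (§(a)–(e),
p635072) and `…GramRShardsLocal` (§(f)–(g) in their rev-2 form, whose `wardD4CertGe_of_shardsRLV` keeps its direct proof);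
this module carries rev 3's NEW text byte-identically: the generic theorem `wardD4CertGe_of_facts₂ZR` (+ `supp_of_gramROK`,
`PSupp_shardPolysL`) and §(h)–(i); the two toy end-to-end theorems of §(i) are `example`s (their statement is
`…GramRSoundB`'s toy bound).  Nothing of the earlier modules is touched.)

§(h) GROUPED R-shards (the byte lever): `splitRuns sizes K.gramR` (runs of consecutive R-blocks of the shipped lengths
`sizes`, the remainder as the last run — `flatten_splitRuns` needs no side condition; the converter orders the blocks, so runs
realise any grouping), `groupShardR c run` (a run's representative chunks concatenated = ONE shard, ONE partial literal),
`shardPolysRG K c sizes := shardPolysL K.toSymCert c ++ runs.map (groupShardR c)`, `sum_shardPolysRG`, `runAt` / `shardPolyAtRGFast`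
(+ `_eq`), `shardCountRG` (+ `_eq`), `shardOKRGV` / `ShardFactsRGV` / `facts₂Z_of_shardFactsRGV`, **`wardD4CertGe_of_shardsRGV`** and
`energyDensity_ge_of_shardsRGV` — corollaries of ONE generic theorem `wardD4CertGe_of_facts₂ZR` (any frame-supported shard list
with the R operator sum + `Facts₂Z` + zero final canon ⇒ `WardD4CertGe`); §(i) `toyRCert` through the grouped pipe with
`sizes = [1]` (three shards) and `sizes = []` (ONE Gram group; two shards).

GROUPED CLOSING GRAMMAR of an R-literal `K := decodeSymCertR (toks certS) (toks gramRS)` (recommended when the shipped partials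
must stay few): the literal `sizes : List ℕ` (run lengths over the shipped R-block order, `J = sizes.length + 1` Gram shards;
e.g. `J = 2–4` on v0′), per shard `shard_j : shardOKRGV K c sizes j P_j = true := by native_decide` (shard 0 = the T16 local
base via `shardPolyAtLFast`, shards 1…J = `groupShardR c run`; pick `c ≥ max rows` so one chunk per block), per R-block
`rok_i : gramROKAt K i = true`, `hRok := gramR_all_of_facts K n hn ⟨rok_0, …, trivial⟩`, `hcount : shardCountRG K c sizes = m + 1`,
`hfacts : ShardFactsRGV K c sizes 0 [P₀,…] := ⟨shard_0, …, trivial⟩`, `hfin : isZero (canonNFZV K.frame [P₀,…].flatten) = true`,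
close with `energyDensity_ge_of_shardsRGV K hwf hRok c sizes [P₀,…] hcount hfacts hfin` (or `nearCertWardSlack_of_wardD4CertGe
(wardD4CertGe_of_shardsRGV …) (by norm_num)` for the registered `≥ −83/100` stub).

HONEST FRAMING: plumbing for a checker COST/BYTE lever with its soundness theorem; no certificate beyond the toy is replayed; no
bound of record moves; no summit or crux statement is proved here; nothing here predicts superconductivity.
-/

noncomputable section

namespace Summit.Ventures.CertifiedManyBodySolver.Theorems.SymReplay

open Matrix Finset
open Literature.MathematicalPhysics.QuantumLattice
open Literature.MathematicalPhysics.QuantumLattice.HubbardWave0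
open Literature.MathematicalPhysics.QuantumLattice.ThermodynamicLimit
open Literature.Probability.LatticeModels
open Literature.MathematicalPhysics.QuantumManyBody.StateRelaxation
open Summit.Ventures.CertifiedManyBodySolver.Theorems.WardSlot
open scoped ComplexOrder BigOperators

/-! ##### (f′) Generic soundness of an R-shard list (rev 3) -/

/-- **GENERIC SOUNDNESS OF AN R-SHARD LIST** (the one proof behind every sharded R-closing below): any list `Qs` of
frame-supported polynomials whose operator sum is `LHS − RHS_R` in every window containing the frame, with two-list facts
`Facts₂Z` against shipped partials `Ps` whose concatenation canonicalises to zero, certifies `WardD4CertGe (symValueR K)` —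
given the R-blocks' side conditions.  Proof = the `…GramRShards` assembly: derived use family (shard canon uses ++ final canon
uses ++ negated block uses), envelope of `K♯`, `facts₂Z_sum`, `canonNFZV_expansion`, `polyOp_rhsPoly_expand`,
`wardD4CertGe_of_expansion K♯`. -/
theorem wardD4CertGe_of_facts₂ZR (K : SymCertR) (hwf0 : wellFormed K.expand = true)
    (hRok : K.gramR.all (gramBlockROK K.frame) = true) (Qs Ps : List QPoly)
    (hQ : ∀ Q ∈ Qs, PSupp Q K.frame.toFinset)
    (hsumQ : ∀ Λ' : Finset (Site 2), K.frame.toFinset ⊆ Λ' →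
      (Qs.map (polyOp Λ')).sum = polyOp Λ' (lhsPoly K.toSymCert) - polyOp Λ' (rhsPolyR K))
    (hF : Facts₂Z K.toSymCert Qs Ps) (hfin : isZero (canonNFZV K.frame Ps.flatten) = true) :
    WardD4CertGe ((symValueR K : ℚ) : ℝ) := by
  have hRok' : ∀ B ∈ K.gramR, gramBlockROK K.frame B = true := List.all_eq_true.1 hRok
  have hsD : ∀ B ∈ K.gramR, (∀ s ∈ B.reps, PSupp s K.frame.toFinset) ∧ ∀ q ∈ genBasis B, PSupp q K.frame.toFinset :=
    fun B hB => ⟨fun s hs => ((gramBlockROK_spec (hRok' B hB)).1 s hs).1, fun q hq => by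
      rw [genBasis, List.mem_map] at hq
      obtain ⟨s, hs, rfl⟩ := hq
      exact PSupp_genOne ((gramBlockROK_spec (hRok' B hB)).1 s hs).2⟩
  /- the DERIVED use family and its envelope -/
  let U := (Qs.flatMap (canonNFZUses K.frame) ++ canonNFZUses K.frame Ps.flatten) ++
    (K.gramR.flatMap blockUses).map negUse
  have hL : (envelope K.expand U).toList.toFinset = envelope K.expand U := Finset.toList_toFinset _
  have hFL : K.frame.toFinset ⊆ (envelope K.expand U).toList.toFinset := by
    rw [hL]; exact (subset_thicken _ 1).trans (thicken_subset_envelope K.expand U)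
  obtain ⟨hsum, hPs⟩ := facts₂Z_sum K.toSymCert hFL Qs Ps hF hQ
  have hU : ∀ e ∈ U, SuppIn e.u K.expand.frame.toFinset := by
    intro e he
    rcases List.mem_append.1 he with he | he
    · rcases List.mem_append.1 he with he | he
      · rw [List.mem_flatMap] at he
        obtain ⟨Q, hQ', he⟩ := he
        exact canonNFZUses_supp K.frame Q (hQ Q hQ') e he
      · exact canonNFZUses_supp K.frame _ hPs e he
    · rw [List.mem_map] at he
      obtain ⟨e', he', rfl⟩ := he
      rw [List.mem_flatMap] at he'
      obtain ⟨B, hB, he'⟩ := he'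
      rw [blockUses, List.mem_flatMap] at he'
      obtain ⟨m, -, he'⟩ := he'
      obtain ⟨t, ht, hu⟩ := polyUses_u he'
      show SuppIn e'.u K.frame.toFinset
      rw [hu]
      exact PSupp_gramBlockPolyR B (hsD B hB).1 (hsD B hB).2 t ht
  refine wardD4CertGe_of_expansion K.expand hwf0 U hU ?_
  /- the expansion -/
  have hBL : ∀ B ∈ K.gramR, (∀ s ∈ B.reps, PSupp (genPre B.moves s) (envelope K.expand U).toList.toFinset) ∧
      ∀ q ∈ genBasis B, ∀ m ∈ B.moves,
        PSupp (movePolyF m.γ m.v q) (envelope K.expand U).toList.toFinset ∧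
          isZero (psub (nfPoly (movePolyF m.γ m.v q)) (pscale m.χ q)) = true := fun B hB =>
    ⟨fun s hs => (((gramBlockROK_spec (hRok' B hB)).1 s hs).2).mono hFL,
      fun q hq m hm => ⟨((gramBlockROK_spec (hRok' B hB)).2 q hq m hm).1.mono hFL,
        ((gramBlockROK_spec (hRok' B hB)).2 q hq m hm).2⟩⟩
  have h2 := polyOp_rhsPoly_expand (envelope K.expand U).toList.toFinset K hBL
  have hfinal := canonNFZV_expansion K.frame hFL Ps.flatten (hPs.mono hFL)
  rw [polyOp_eq_zero_of_isZero _ _ hfin, zero_add] at hfinal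
  rw [hsumQ _ hFL] at hsum
  have hl : lhsPoly K.expand = lhsPoly K.toSymCert := rfl
  have hneg : (((K.gramR.flatMap blockUses).map negUse).map (useOp (envelope K.expand U).toList.toFinset)).sum =
      -((K.gramR.flatMap blockUses).map (useOp (envelope K.expand U).toList.toFinset)).sum := by
    rw [List.map_map, ← list_sum_map_neg]
    simp only [Function.comp_def, useOp_negUse]
  rw [hl, h2, List.map_append, List.sum_append, List.map_append, List.sum_append, ← hfinal, hneg,
    sub_eq_iff_eq_add.1 hsum]
  abel

/-- The R-blocks' representatives and generated bases are supported in the frame (from the side conditions). -/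
theorem supp_of_gramROK (K : SymCertR) (hRok : K.gramR.all (gramBlockROK K.frame) = true) :
    ∀ B ∈ K.gramR, (∀ s ∈ B.reps, PSupp s K.frame.toFinset) ∧ ∀ q ∈ genBasis B, PSupp q K.frame.toFinset :=
  fun B hB => ⟨fun s hs => ((gramBlockROK_spec (List.all_eq_true.1 hRok B hB)).1 s hs).1, fun q hq => by
    rw [genBasis, List.mem_map] at hq
    obtain ⟨s, hs, rfl⟩ := hq
    exact PSupp_genOne ((gramBlockROK_spec (List.all_eq_true.1 hRok B hB)).1 s hs).2⟩

/-- T16b's local shards of the base certificate are supported in the frame. -/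
theorem PSupp_shardPolysL (K : SymCert) (hwf : wellFormed K = true) (c : ℕ) :
    ∀ Q ∈ shardPolysL K c, PSupp Q K.frame.toFinset := by
  have hgM' : ∀ B ∈ K.gramM, ∀ q ∈ B.basis, PSupp q K.frame.toFinset := fun B hB q hq => by
    have hwf' := hwf
    simp only [wellFormed, Bool.and_eq_true] at hwf'
    obtain ⟨⟨⟨⟨⟨⟨⟨⟨⟨⟨⟨⟨⟨-, -⟩, -⟩, -⟩, -⟩, -⟩, hgM⟩, -⟩, -⟩, -⟩, -⟩, -⟩, -⟩, -⟩ := hwf'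
    have h := List.all_eq_true.1 hgM B hB
    simp only [gramBlockOK, Bool.and_eq_true, List.all_eq_true] at h
    exact PSupp_of_psuppIn (h.2 q hq)
  intro Q hQ
  rw [shardPolysL, List.mem_cons] at hQ
  rcases hQ with rfl | hQ
  · exact (PSupp_lhsPoly K (thicken_zero_subset_of_wellFormed K hwf)).psub (PSupp_rhsNonBlockL K hwf)
  · rw [List.mem_flatMap] at hQ
    obtain ⟨B, hB, hQ⟩ := hQ
    exact PSupp_blockShardPolys c B (hgM' B hB) Q hQ

/-! ##### (h) GROUPED R-shards — runs of consecutive R-blocks as ONE shard each (few shards `J` ⇒ few shipped partial literals;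
hub-lb-sym-plan-1 PARTIALS-BYTES: the partial literals are the dominant byte item of a sharded landing and `J` is the lever) -/

/-- Split a list into consecutive runs of the given sizes; whatever the sizes leave over is the LAST run (so the runs always
re-assemble the list, with no side condition; `sizes.length + 1` runs). The converter orders the R-blocks freely, so runs of a
shipped `sizes` list realise any grouping. -/
def splitRuns {α : Type} : List ℕ → List α → List (List α)
  | [], l => [l]
  | n :: ns, l => l.take n :: splitRuns ns (l.drop n)

/-- The runs concatenate back to the list (no side condition: the remainder is the last run). -/
theorem flatten_splitRuns {α : Type} : ∀ (ns : List ℕ) (l : List α), (splitRuns ns l).flatten = l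
  | [], l => by simp [splitRuns]
  | n :: ns, l => by rw [splitRuns, List.flatten_cons, flatten_splitRuns ns, List.take_append_drop]

/-- There are `sizes.length + 1` runs. -/
theorem length_splitRuns {α : Type} : ∀ (ns : List ℕ) (l : List α), (splitRuns ns l).length = ns.length + 1
  | [], l => rfl
  | n :: ns, l => by rw [splitRuns, List.length_cons, length_splitRuns ns, List.length_cons]

/-- Run `i` computed alone (only `take`/`drop` walking; no other run is built). -/
def runAt {α : Type} : List ℕ → List α → ℕ → List α
  | [], l, 0 => l
  | [], _, _ + 1 => []
  | n :: _, l, 0 => l.take n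
  | n :: ns, l, i + 1 => runAt ns (l.drop n) i

/-- The fast run accessor agrees with indexing `splitRuns`. -/
theorem runAt_eq {α : Type} : ∀ (ns : List ℕ) (l : List α) (i : ℕ), runAt ns l i = ((splitRuns ns l)[i]?).getD []
  | [], l, 0 => by simp [runAt, splitRuns]
  | [], l, i + 1 => by simp [runAt, splitRuns]
  | n :: ns, l, 0 => by simp [runAt, splitRuns]
  | n :: ns, l, i + 1 => by rw [runAt, splitRuns, List.getElem?_cons_succ]; exact runAt_eq ns _ i

/-- The GROUP shard of a run of R-blocks: all their (negated, scaled) representative row chunks concatenated. -/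
def groupShardR (c : ℕ) (Bs : List GramBlockR) : QPoly := (Bs.flatMap (blockShardPolysR c)).flatten

/-- The operator of a concatenation is the sum of the operators. -/
theorem polyOp_flatten_eq_sum (Λ' : Finset (Site 2)) : ∀ (l : List QPoly), polyOp Λ' l.flatten = (l.map (polyOp Λ')).sum
  | [] => by simp
  | p :: l => by rw [List.flatten_cons, polyOp_append, polyOp_flatten_eq_sum Λ' l, List.map_cons, List.sum_cons]

/-- A group shard reads as minus the run's scaled representative block polynomials. -/
theorem polyOp_groupShardR (Λ' : Finset (Site 2)) (c : ℕ) (Bs : List GramBlockR) :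
    polyOp Λ' (groupShardR c Bs) = -polyOp Λ' (Bs.flatMap fun B => pscale (B.moves.length : ℚ) (gramBlockPolyR B)) := by
  rw [groupShardR, polyOp_flatten_eq_sum, sum_flatMap_blockShardPolysR]

/-- A group shard is supported where the run's representatives and generated bases are. -/
theorem PSupp_groupShardR (c : ℕ) (Bs : List GramBlockR) {Λ : Finset (Site 2)}
    (h : ∀ B ∈ Bs, (∀ s ∈ B.reps, PSupp s Λ) ∧ ∀ q ∈ genBasis B, PSupp q Λ) : PSupp (groupShardR c Bs) Λ := by
  intro t ht
  rw [groupShardR, List.mem_flatten] at ht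
  obtain ⟨Q, hQ, ht⟩ := ht
  rw [List.mem_flatMap] at hQ
  obtain ⟨B, hB, hQ⟩ := hQ
  exact PSupp_blockShardPolysR c B (h B hB).1 (h B hB).2 Q hQ t ht

/-- **GROUPED local R-shard list**: T16b's local shards of the base certificate, then ONE shard per run of R-blocks. -/
def shardPolysRG (K : SymCertR) (c : ℕ) (sizes : List ℕ) : List QPoly :=
  shardPolysL K.toSymCert c ++ (splitRuns sizes K.gramR).map (groupShardR c)

/-- The grouped shards have the operator sum of the R-shards (in any window containing the frame). -/
theorem sum_shardPolysRG {Λ' : Finset (Site 2)} (K : SymCertR) (hwf : wellFormed K.toSymCert = true)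
    (hFL : K.frame.toFinset ⊆ Λ') (c : ℕ) (sizes : List ℕ) :
    ((shardPolysRG K c sizes).map (polyOp Λ')).sum = polyOp Λ' (lhsPoly K.toSymCert) - polyOp Λ' (rhsPolyR K) := by
  have hruns : ∀ L : List (List GramBlockR), ((L.map (groupShardR c)).map (polyOp Λ')).sum =
      -polyOp Λ' (L.flatten.flatMap fun B => pscale (B.moves.length : ℚ) (gramBlockPolyR B)) := by
    intro L
    induction L with
    | nil => simp
    | cons Bs L ih =>
      rw [List.map_cons, List.map_cons, List.sum_cons, ih, List.flatten_cons, List.flatMap_append, polyOp_append,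
        polyOp_groupShardR, neg_add]
  rw [shardPolysRG, List.map_append, List.sum_append, sum_shardPolysL K.toSymCert hwf hFL c, hruns, flatten_splitRuns,
    rhsPolyR, polyOp_append]
  abel

/-- **Grouped local R-shard `j`, computed alone.** -/
def shardPolyAtRGFast (K : SymCertR) (c : ℕ) (sizes : List ℕ) (j : ℕ) : QPoly :=
  if j < shardCount K.toSymCert c then shardPolyAtLFast K.toSymCert c j
  else groupShardR c (runAt sizes K.gramR (j - shardCount K.toSymCert c))

/-- The fast grouped accessor agrees with indexing `shardPolysRG`. -/
theorem shardPolyAtRGFast_eq (K : SymCertR) (c : ℕ) (sizes : List ℕ) (j : ℕ) :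
    shardPolyAtRGFast K c sizes j = ((shardPolysRG K c sizes)[j]?).getD [] := by
  unfold shardPolyAtRGFast shardPolysRG
  split_ifs with h
  · rw [shardPolyAtLFast_eq, List.getElem?_append_left (by rwa [← shardCount_eq_lengthL])]
  · rw [List.getElem?_append_right (by rw [← shardCount_eq_lengthL]; omega), ← shardCount_eq_lengthL, runAt_eq,
      List.getElem?_map]
    cases (splitRuns sizes K.gramR)[j - shardCount K.toSymCert c]? with
    | none => rfl
    | some Bs => rfl

/-- Number of grouped shards, cheaply: base shards + `sizes.length + 1` runs. -/
def shardCountRG (K : SymCertR) (c : ℕ) (sizes : List ℕ) : ℕ := shardCount K.toSymCert c + (sizes.length + 1)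

/-- The fast grouped count IS the number of grouped shards. -/
theorem shardCountRG_eq (K : SymCertR) (c : ℕ) (sizes : List ℕ) :
    shardCountRG K c sizes = (shardPolysRG K c sizes).length := by
  rw [shardCountRG, shardPolysRG, List.length_append, shardCount_eq_lengthL, List.length_map, length_splitRuns]

/-- **What ONE farm call proves about grouped shard `j`** (zero-filtered executed pipe). -/
def shardOKRGV (K : SymCertR) (c : ℕ) (sizes : List ℕ) (j : ℕ) (P : QPoly) : Bool :=
  psuppIn P K.frame && isZero (psub (canonNFZV K.frame (shardPolyAtRGFast K c sizes j)) P)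

/-- The per-call facts, grouped form (structural on the literal partial list). -/
def ShardFactsRGV (K : SymCertR) (c : ℕ) (sizes : List ℕ) : ℕ → List QPoly → Prop
  | _, [] => True
  | j, P :: Ps => shardOKRGV K c sizes j P = true ∧ ShardFactsRGV K c sizes (j + 1) Ps

/-- Index-based grouped facts give T16b's two-list facts `Facts₂Z` on the corresponding suffix of `shardPolysRG`. -/
theorem facts₂Z_of_shardFactsRGV (K : SymCertR) (c : ℕ) (sizes : List ℕ) :
    ∀ (Ps : List QPoly) (j : ℕ), ((shardPolysRG K c sizes).drop j).length = Ps.length →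
      ShardFactsRGV K c sizes j Ps → Facts₂Z K.toSymCert ((shardPolysRG K c sizes).drop j) Ps
  | [], j, hl, _ => by
    rw [List.length_nil, List.length_eq_zero_iff] at hl
    rw [hl]; trivial
  | P :: Ps, j, hl, hf => by
    have hj : j < (shardPolysRG K c sizes).length := by
      rw [List.length_drop, List.length_cons] at hl; omega
    rw [List.drop_eq_getElem_cons hj]
    have hQ : shardPolyAtRGFast K c sizes j = (shardPolysRG K c sizes)[j] := by
      rw [shardPolyAtRGFast_eq, List.getElem?_eq_getElem hj]; rfl
    refine ⟨?_, facts₂Z_of_shardFactsRGV K c sizes Ps (j + 1) ?_ hf.2⟩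
    · rw [← hQ]; exact hf.1
    · have := hl; rw [List.drop_eq_getElem_cons hj, List.length_cons, List.length_cons] at this; omega

/-- **GROUPED SHARDED LOCAL R-REPLAY IS SOUND.** -/
theorem wardD4CertGe_of_shardsRGV (K : SymCertR) (hwf0 : wellFormed K.expand = true)
    (hRok : K.gramR.all (gramBlockROK K.frame) = true) (c : ℕ) (sizes : List ℕ) (Ps : List QPoly)
    (hcount : shardCountRG K c sizes = Ps.length) (hfacts : ShardFactsRGV K c sizes 0 Ps)
    (hfin : isZero (canonNFZV K.frame Ps.flatten) = true) : WardD4CertGe ((symValueR K : ℚ) : ℝ) := by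
  have hwfb : wellFormed K.toSymCert = true := wellFormed_toSymCert_of_expand K hwf0
  have hsD := supp_of_gramROK K hRok
  have hQ : ∀ Q ∈ shardPolysRG K c sizes, PSupp Q K.frame.toFinset := by
    intro Q hQ
    rcases List.mem_append.1 hQ with hQ | hQ
    · exact PSupp_shardPolysL K.toSymCert hwfb c Q hQ
    · rw [List.mem_map] at hQ
      obtain ⟨Bs, hBs, rfl⟩ := hQ
      refine PSupp_groupShardR c Bs fun B hB => hsD B ?_
      rw [← flatten_splitRuns sizes K.gramR, List.mem_flatten]
      exact ⟨Bs, hBs, hB⟩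
  have hlen : (shardPolysRG K c sizes).length = Ps.length := (shardCountRG_eq K c sizes).symm.trans hcount
  have hF : Facts₂Z K.toSymCert (shardPolysRG K c sizes) Ps := by
    have h := facts₂Z_of_shardFactsRGV K c sizes Ps 0 (by rw [List.drop_zero]; exact hlen) hfacts
    rwa [List.drop_zero] at h
  exact wardD4CertGe_of_facts₂ZR K hwf0 hRok _ Ps hQ (fun Λ' hFL => sum_shardPolysRG K hwfb hFL c sizes) hF hfin

/-- **Grouped sharded local R-replay, closing theorem.**  CLOSING GRAMMAR: as `energyDensity_ge_of_shardsRLV` with the extra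
literal `sizes` (run lengths over the shipped R-block order; `J = sizes.length + 1` Gram shards), shard facts
`shardOKRGV K c sizes j P_j` and `hcount : shardCountRG K c sizes = m + 1`. -/
theorem energyDensity_ge_of_shardsRGV (K : SymCertR) (hwf : wellFormed K.expand = true)
    (hRok : K.gramR.all (gramBlockROK K.frame) = true) (c : ℕ) (sizes : List ℕ) (Ps : List QPoly)
    (hcount : shardCountRG K c sizes = Ps.length) (hfacts : ShardFactsRGV K c sizes 0 Ps)
    (hfin : isZero (canonNFZV K.frame Ps.flatten) = true) :
    ((symValueR K : ℚ) : ℝ) ≤ energyDensityTT' 1 0 8 (7 / 8) :=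
  energyDensity_ge_of_windowSound_cert _ WardSlot.stub_wardWindowSound
    (wardD4CertGe_of_shardsRGV K hwf hRok c sizes Ps hcount hfacts hfin)

/-! ##### (i) Kernel demo: `toyRCert` through the GROUPED pipe — `sizes = [1]` (runs `[B₀], [B₁]`: the same three shards and
partials as §(g)) and `sizes = []` (ONE run `[B₀, B₁]`: two shards) -/

example : ((symValueR toyRCert : ℚ) : ℝ) ≤ energyDensityTT' 1 0 8 (7 / 8) :=
  energyDensity_ge_of_shardsRGV toyRCert (by decide +kernel)
    (gramR_all_of_facts toyRCert 2 (by decide +kernel) ⟨by decide +kernel, by decide +kernel, trivial⟩) 0 [1] toyRLPartials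
    (by decide +kernel) ⟨by decide +kernel, by decide +kernel, by decide +kernel, trivial⟩ (by decide +kernel)

/-- One Gram group: partials = the base partial and the canonical form of the whole R part. -/
def toyRGPartials : List QPoly :=
  [canonNFZV toyRCert.frame (shardPolyAtRGFast toyRCert 0 [] 0), canonNFZV toyRCert.frame (shardPolyAtRGFast toyRCert 0 [] 1)]

example : ((symValueR toyRCert : ℚ) : ℝ) ≤ energyDensityTT' 1 0 8 (7 / 8) :=
  energyDensity_ge_of_shardsRGV toyRCert (by decide +kernel)
    (gramR_all_of_facts toyRCert 2 (by decide +kernel) ⟨by decide +kernel, by decide +kernel, trivial⟩) 0 [] toyRGPartials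
    (by decide +kernel) ⟨by decide +kernel, by decide +kernel, trivial⟩ (by decide +kernel)

/-- Fewer shards, fewer shipped terms (the byte law on the toy): the grouped partial list is no longer than the per-block one. -/
example : (toyRGPartials.map List.length).sum ≤ (toyRLPartials.map List.length).sum := by decide +kernel

end Summit.Ventures.CertifiedManyBodySolver.Theorems.SymReplay
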